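import Summits.QuantumAdvantage.QuantumAdvantage.Theorems.SpreadCoreBridgeA
import Summits.QuantumAdvantage.QuantumAdvantage.Theorems.SpreadBridge

/-! # SpreadCoreBridgeB — part 2/3 (mechanical split for landing of `SpreadCoreBridge`; content verbatim; scopes re-opened with their variables) -/

open Finset
open Literature.Computability.Cryptography Literature.Computability.Complexity
open Literature.Computability.QuantumComplexity Literature.Computability.MetaComplexity
set_option linter.dupNamespace false

namespace Summit.QuantumAdvantage.QuantumAdvantage.Theorems.SpreadCore
open Summit.QuantumAdvantage.AdviceFreeQNC0 Summit.QuantumAdvantage.QuantumAdvantage.Theorems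
open scoped Classical
open Summit.QuantumAdvantage.QuantumAdvantage.Theses.HardCore (RingPolyLoss8Odd GridCoreDistOdd DistLiftOdd DistBridgeOdd RingCore8Odd)

/-! ## Part C.  THE WEIGHTED HYBRID LEMMA (PROVED edge `SpreadDistOdd → MultiRingDistOdd`)

Port of lens-5's flat hybrid argument (`SpreadDial.card_winAllSet_le_hybrid`, cell decomp-qadv seat lens-5, with
attribution) to an ARBITRARY single-ring weight `wt` and the product weight `wt^{⊗m}` on tuples: process the rings one
at a time; on each fibre `{update X j y | y}` the processed rings' wins form a foreign win event for ring `j` (their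
patterns are FIXED on the fibre, their outputs restricted to the fibre stay low-degree by
`Smolensky.comp_subst_mem_lowDeg`), and the fibre carries the weight `wt y · ∏_{i ≠ j} wt (X i)`; so the weighted
masses satisfy `a_{t+1} ≤ (1-d)·a_t + d(1-η)·W^m`, `W = Σ wt`. -/

/-- Flatten `m` patterns of length `n` into one point of the `(m·n)`-cube. [bookkeeping] -/
def flat {m n : ℕ} (X : Fin m → Fin n → Bool) : Fin (m * n) → Bool :=
  fun k => X (finProdFinEquiv.symm k).1 (finProdFinEquiv.symm k).2

/-- Weighted averaging over one coordinate: `Σ_X Σ_y G (update X j y) = |α| · Σ_X G X`. [bookkeeping] -/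
theorem sum_sum_update {ι α : Type*} [Fintype ι] [DecidableEq ι] [Fintype α] [DecidableEq α]
    (j : ι) (G : (ι → α) → ℝ) :
    ∑ X : ι → α, ∑ y : α, G (Function.update X j y) = (Fintype.card α : ℝ) * ∑ X : ι → α, G X := by
  set e := Equiv.funSplitAt j α with he
  have hupd : ∀ (X : ι → α) (y : α), Function.update X j y = e.symm (y, (e X).2) := by
    intro X y
    funext i
    by_cases hi : i = j
    · subst hi
      simp [he, Equiv.funSplitAt, Equiv.piSplitAt]
    · simp [he, Equiv.funSplitAt, Equiv.piSplitAt, hi]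
  let g : ({i // i ≠ j} → α) → ℝ := fun r => ∑ y : α, G (e.symm (y, r))
  calc ∑ X : ι → α, ∑ y : α, G (Function.update X j y)
      = ∑ X : ι → α, g (e X).2 := by
        refine Finset.sum_congr rfl fun X _ => ?_
        simp only [g, hupd]
    _ = ∑ q : α × ({i // i ≠ j} → α), g q.2 := by
        rw [← e.symm.sum_comp (fun X => g (e X).2)]
        simp only [Equiv.apply_symm_apply]
    _ = ∑ _a : α, ∑ r : {i // i ≠ j} → α, g r :=
        Fintype.sum_prod_type (fun q : α × ({i // i ≠ j} → α) => g q.2)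
    _ = (Fintype.card α : ℝ) * ∑ r : {i // i ≠ j} → α, g r := by
        rw [Finset.sum_const, Finset.card_univ, nsmul_eq_mul]
    _ = (Fintype.card α : ℝ) * ∑ X : ι → α, G X := by
        congr 1
        have h2 : ∑ q : α × ({i // i ≠ j} → α), G (e.symm q)
            = ∑ y : α, ∑ r : {i // i ≠ j} → α, G (e.symm (y, r)) :=
          Fintype.sum_prod_type (fun q : α × ({i // i ≠ j} → α) => G (e.symm q))
        calc ∑ r : {i // i ≠ j} → α, g r = ∑ r : {i // i ≠ j} → α, ∑ y : α, G (e.symm (y, r)) := rfl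
          _ = ∑ y : α, ∑ r : {i // i ≠ j} → α, G (e.symm (y, r)) := Finset.sum_comm
          _ = ∑ q : α × ({i // i ≠ j} → α), G (e.symm q) := h2.symm
          _ = ∑ X : ι → α, G X := e.symm.sum_comp G

/-- Filtered form: `Σ_X Σ_{y : Φ (update X j y)} G (update X j y) = |α| · Σ_{X : Φ X} G X`. [bookkeeping] -/
theorem sum_filter_update {ι α : Type*} [Fintype ι] [DecidableEq ι] [Fintype α] [DecidableEq α]
    (j : ι) (Φ : (ι → α) → Prop) [DecidablePred Φ] (G : (ι → α) → ℝ) :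
    ∑ X : ι → α, ∑ y ∈ univ.filter (fun y : α => Φ (Function.update X j y)), G (Function.update X j y)
      = (Fintype.card α : ℝ) * ∑ X ∈ univ.filter Φ, G X := by
  have h := sum_sum_update j (fun Z => if Φ Z then G Z else 0)
  rw [Finset.sum_filter]
  rw [← h]
  refine Finset.sum_congr rfl fun X _ => ?_
  rw [Finset.sum_filter]

/-- **The weighted hybrid lemma** (any prime `p`, `m` rings of length `n`, degree bound `D`, loss rate `d`, density
threshold `1-η`, single-ring weight `wt`, `W = Σ wt`): if every single-ring strategy of degree `≤ D` keeps weighted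
loss `d·W` inside every foreign win event of weight `≥ (1-η)W` cut out by `< m` foreign rings, then every JOINT
degree-`≤ D` strategy for `m` rings wins all rings on weighted mass `≤ ((1-η) + η(1-d)^m)·W^m` under `wt^{⊗m}`.
[kernel] -/
theorem sum_winAll_le_hybrid_wt {p : ℕ} [Fact p.Prime] {n m D : ℕ} {η d : ℝ}
    (hη1 : η ≤ 1) (hd0 : 0 ≤ d) (hd1 : d ≤ 1) (wt : (Fin n → Bool) → ℕ)
    (P : Fin m → Fin n → Smolensky.CubeFn (ZMod p) (m * n))
    (hP : ∀ j i, P j i ∈ Smolensky.lowDeg (ZMod p) (m * n) D)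
    (hS : ∀ Pv : Fin n → Smolensky.CubeFn (ZMod p) n, (∀ i, Pv i ∈ Smolensky.lowDeg (ZMod p) n D) →
      ∀ t : ℕ, t < m → ∀ w : Fin t → Fin n → Bool, ∀ Q : Fin t → Fin n → Smolensky.CubeFn (ZMod p) n,
        (∀ s i, Q s i ∈ Smolensky.lowDeg (ZMod p) n D) →
        (1 - η) * ((∑ y, wt y : ℕ) : ℝ) ≤ ((∑ y ∈ univ.filter (fun y : Fin n → Bool =>
            ∀ s, RingHLF.Rel (w s) (fun i => decide (Q s i y = 1))), wt y : ℕ) : ℝ) →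
        d * ((∑ y, wt y : ℕ) : ℝ) ≤ ((∑ y ∈ univ.filter (fun y : Fin n → Bool =>
            (∀ s, RingHLF.Rel (w s) (fun i => decide (Q s i y = 1))) ∧
              ¬ RingHLF.Rel y (fun i => decide (Pv i y = 1))), wt y : ℕ) : ℝ)) :
    (∑ X ∈ univ.filter (fun X : Fin m → Fin n → Bool =>
        ∀ j, RingHLF.Rel (X j) (fun i => decide (P j i (flat X) = 1))), ∏ j, ((wt (X j) : ℕ) : ℝ))
      ≤ ((1 - η) + η * (1 - d) ^ m) * ((∑ y, wt y : ℕ) : ℝ) ^ m := by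
  classical
  -- sizes and weights
  set W : ℝ := ((∑ y, wt y : ℕ) : ℝ) with hW
  set N : ℝ := (2 : ℝ) ^ n with hN
  have hNpos : 0 < N := by positivity
  have hW0 : 0 ≤ W := by positivity
  have hWsum : ∑ y : Fin n → Bool, ((wt y : ℕ) : ℝ) = W := by rw [hW]; push_cast; rfl
  have hcardY : (Fintype.card (Fin n → Bool) : ℝ) = N := by
    rw [Fintype.card_fun, Fintype.card_bool, Fintype.card_fin]; push_cast; rfl
  let ω : (Fin m → Fin n → Bool) → ℝ := fun X => ∏ j, ((wt (X j) : ℕ) : ℝ)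
  have hSumω : ∑ X : Fin m → Fin n → Bool, ω X = W ^ m := by
    have h1 := Fintype.prod_sum fun (_ : Fin m) (y : Fin n → Bool) => ((wt y : ℕ) : ℝ)
    rw [hWsum, Finset.prod_const, Finset.card_univ, Fintype.card_fin] at h1
    exact h1.symm
  -- win predicate of ring `s` and the hybrid masses `a t` (rings `< t` win)
  let Win : Fin m → (Fin m → Fin n → Bool) → Prop := fun s X =>
    RingHLF.Rel (X s) (fun i => decide (P s i (flat X) = 1))
  let a : ℕ → ℝ := fun t => ∑ X ∈ univ.filter (fun X => ∀ s : Fin m, (s : ℕ) < t → Win s X), ω X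
  -- one hybrid step
  have hstep : ∀ t : ℕ, t < m → a (t + 1) ≤ (1 - d) * a t + d * ((1 - η) * W ^ m) := by
    intro t ht
    let j : Fin m := ⟨t, ht⟩
    have hupd_ne : ∀ (X : Fin m → Fin n → Bool) (y : Fin n → Bool) (s : Fin m), (s : ℕ) < t →
        Function.update X j y s = X s := by
      intro X y s hs
      apply Function.update_of_ne
      intro hsj
      rw [hsj] at hs
      exact lt_irrefl _ hs
    -- the weight of the fibre through `X` at coordinate `j`
    let ρ : (Fin m → Fin n → Bool) → ℝ := fun X => ∏ i ∈ univ.erase j, ((wt (X i) : ℕ) : ℝ)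
    have hρ0 : ∀ X, 0 ≤ ρ X := fun X => Finset.prod_nonneg fun i _ => by positivity
    have hωupd : ∀ (X : Fin m → Fin n → Bool) (y : Fin n → Bool),
        ω (Function.update X j y) = ((wt y : ℕ) : ℝ) * ρ X := by
      intro X y
      simp only [ω, ρ]
      rw [← Finset.mul_prod_erase univ (fun i => ((wt (Function.update X j y i) : ℕ) : ℝ)) (mem_univ j),
        Function.update_self]
      congr 1
      refine Finset.prod_congr rfl fun i hi => ?_
      rw [Function.update_of_ne (Finset.ne_of_mem_erase hi)]
    -- fibrewise bound
    have hfib : ∀ X : Fin m → Fin n → Bool,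
        (∑ y ∈ univ.filter (fun y : Fin n → Bool =>
            ∀ s : Fin m, (s : ℕ) < t + 1 → Win s (Function.update X j y)), ω (Function.update X j y))
          ≤ (1 - d) * (∑ y ∈ univ.filter (fun y : Fin n → Bool =>
            ∀ s : Fin m, (s : ℕ) < t → Win s (Function.update X j y)), ω (Function.update X j y))
            + d * ((1 - η) * W) * ρ X := by
      intro X
      -- the substitution `y ↦ flat (update X j y)` fixes every coordinate outside ring `j`
      let emb : (Fin n → Bool) → (Fin (m * n) → Bool) := fun y => flat (Function.update X j y)
      have hemb : ∀ kk, (∃ b, ∀ u, emb u kk = b) ∨ (∃ s, ∀ u, emb u kk = u s) := by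
        intro kk
        simp only [emb, flat]
        generalize finProdFinEquiv.symm kk = q
        obtain ⟨r, s⟩ := q
        by_cases hr : r = j
        · right
          refine ⟨s, fun u => ?_⟩
          rw [hr, Function.update_self]
        · left
          refine ⟨X r s, fun u => ?_⟩
          rw [Function.update_of_ne hr]
      let Pv : Fin n → Smolensky.CubeFn (ZMod p) n := fun i y => P j i (emb y)
      have hPv : ∀ i, Pv i ∈ Smolensky.lowDeg (ZMod p) n D := fun i =>
        Smolensky.comp_subst_mem_lowDeg emb hemb (hP j i)
      let w : Fin t → Fin n → Bool := fun s => X ⟨s, lt_trans s.isLt ht⟩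
      let Q : Fin t → Fin n → Smolensky.CubeFn (ZMod p) n := fun s i y => P ⟨s, lt_trans s.isLt ht⟩ i (emb y)
      have hQ : ∀ s i, Q s i ∈ Smolensky.lowDeg (ZMod p) n D := fun s i =>
        Smolensky.comp_subst_mem_lowDeg emb hemb (hP _ i)
      -- the foreign win event of the processed rings on this fibre
      set E := univ.filter fun y : Fin n → Bool =>
        ∀ s : Fin t, RingHLF.Rel (w s) (fun i => decide (Q s i y = 1)) with hEdef
      have hE : (univ.filter fun y : Fin n → Bool =>
          ∀ s : Fin m, (s : ℕ) < t → Win s (Function.update X j y)) = E := by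
        ext y
        simp only [hEdef, mem_filter, mem_univ, true_and]
        constructor
        · intro hy s
          have h1 := hy ⟨s, lt_trans s.isLt ht⟩ s.isLt
          simp only [Win, hupd_ne X y ⟨s, lt_trans s.isLt ht⟩ s.isLt] at h1
          exact h1
        · intro hy s hs
          have h1 := hy ⟨s, hs⟩
          simp only [Win, hupd_ne X y s hs]
          exact h1
      have hEW : (univ.filter fun y : Fin n → Bool =>
          ∀ s : Fin m, (s : ℕ) < t + 1 → Win s (Function.update X j y))
          = E.filter fun y => RingHLF.Rel y (fun i => decide (Pv i y = 1)) := by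
        ext y
        simp only [hEdef, mem_filter, mem_univ, true_and]
        constructor
        · intro hy
          refine ⟨fun s => ?_, ?_⟩
          · have h1 := hy ⟨s, lt_trans s.isLt ht⟩ (Nat.lt_succ_of_lt s.isLt)
            simp only [Win, hupd_ne X y ⟨s, lt_trans s.isLt ht⟩ s.isLt] at h1
            exact h1
          · have h1 := hy j (Nat.lt_succ_self t)
            simp only [Win, Function.update_self] at h1
            exact h1
        · rintro ⟨hy1, hy2⟩ s hs
          rcases Nat.lt_succ_iff_lt_or_eq.mp hs with hs' | hs'
          · have h1 := hy1 ⟨s, hs'⟩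
            simp only [Win, hupd_ne X y s hs']
            exact h1
          · have hsj : s = j := Fin.ext hs'
            rw [hsj]
            simp only [Win, Function.update_self]
            exact hy2
      -- weighted counts on the fibre
      have hsplit := Finset.sum_filter_add_sum_filter_not E
        (fun y : Fin n → Bool => RingHLF.Rel y (fun i => decide (Pv i y = 1))) (fun y => ((wt y : ℕ) : ℝ))
      have heW : (∑ y ∈ E, ((wt y : ℕ) : ℝ)) ≤ W := by
        rw [← hWsum]
        exact Finset.sum_le_sum_of_subset_of_nonneg (Finset.subset_univ E) (fun _ _ _ => by positivity)
      have hl0 : 0 ≤ ∑ y ∈ E.filter (fun y : Fin n → Bool => ¬ RingHLF.Rel y (fun i => decide (Pv i y = 1))),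
          ((wt y : ℕ) : ℝ) := Finset.sum_nonneg fun _ _ => by positivity
      have hsp : (1 - η) * W ≤ (∑ y ∈ E, ((wt y : ℕ) : ℝ)) →
          d * W ≤ ∑ y ∈ E.filter (fun y : Fin n → Bool => ¬ RingHLF.Rel y (fun i => decide (Pv i y = 1))),
            ((wt y : ℕ) : ℝ) := by
        intro hle
        have hle' : (1 - η) * ((∑ y, wt y : ℕ) : ℝ) ≤ ((∑ y ∈ univ.filter (fun y : Fin n → Bool =>
            ∀ s, RingHLF.Rel (w s) (fun i => decide (Q s i y = 1))), wt y : ℕ) : ℝ) := by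
          rw [← hW, ← hEdef]; push_cast; exact hle
        have h1 := hS Pv hPv t ht w Q hQ hle'
        rw [hEdef, Finset.filter_filter]
        push_cast at h1
        exact h1
      have hdec := Summit.QuantumAdvantage.QuantumAdvantage.Theorems.SpreadBridge.fibre_decrement hsplit heW hl0 hW0 hd0 hη1 hsp
      -- translate the fibre sums of `ω` into weighted counts
      have hF1 : (∑ y ∈ univ.filter (fun y : Fin n → Bool =>
            ∀ s : Fin m, (s : ℕ) < t + 1 → Win s (Function.update X j y)), ω (Function.update X j y))
          = ρ X * ∑ y ∈ E.filter (fun y => RingHLF.Rel y (fun i => decide (Pv i y = 1))), ((wt y : ℕ) : ℝ) := by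
        rw [hEW, Finset.mul_sum]
        refine Finset.sum_congr rfl fun y _ => ?_
        rw [hωupd]; ring
      have hF0 : (∑ y ∈ univ.filter (fun y : Fin n → Bool =>
            ∀ s : Fin m, (s : ℕ) < t → Win s (Function.update X j y)), ω (Function.update X j y))
          = ρ X * ∑ y ∈ E, ((wt y : ℕ) : ℝ) := by
        rw [hE, Finset.mul_sum]
        refine Finset.sum_congr rfl fun y _ => ?_
        rw [hωupd]; ring
      rw [hF1, hF0]
      have h2 := mul_le_mul_of_nonneg_left hdec (hρ0 X)
      calc ρ X * ∑ y ∈ E.filter (fun y => RingHLF.Rel y (fun i => decide (Pv i y = 1))), ((wt y : ℕ) : ℝ)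
          ≤ ρ X * ((1 - d) * (∑ y ∈ E, ((wt y : ℕ) : ℝ)) + d * ((1 - η) * W)) := h2
        _ = (1 - d) * (ρ X * ∑ y ∈ E, ((wt y : ℕ) : ℝ)) + d * ((1 - η) * W) * ρ X := by ring
    -- sum the fibrewise bound over all tuples
    have hL : ∑ X : Fin m → Fin n → Bool, (∑ y ∈ univ.filter (fun y : Fin n → Bool =>
          ∀ s : Fin m, (s : ℕ) < t + 1 → Win s (Function.update X j y)), ω (Function.update X j y))
        = N * a (t + 1) := by
      have h1 := sum_filter_update j (fun Z : Fin m → Fin n → Bool => ∀ s : Fin m, (s : ℕ) < t + 1 → Win s Z) ω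
      rw [hcardY] at h1
      exact h1
    have hR : ∑ X : Fin m → Fin n → Bool, (∑ y ∈ univ.filter (fun y : Fin n → Bool =>
          ∀ s : Fin m, (s : ℕ) < t → Win s (Function.update X j y)), ω (Function.update X j y))
        = N * a t := by
      have h1 := sum_filter_update j (fun Z : Fin m → Fin n → Bool => ∀ s : Fin m, (s : ℕ) < t → Win s Z) ω
      rw [hcardY] at h1
      exact h1
    have hρW : ∑ X : Fin m → Fin n → Bool, d * ((1 - η) * W) * ρ X = N * (d * ((1 - η) * W ^ m)) := by
      have h1 := sum_sum_update j ω
      rw [hcardY, hSumω] at h1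
      have h2 : ∀ X : Fin m → Fin n → Bool, ∑ y : Fin n → Bool, ω (Function.update X j y) = W * ρ X := by
        intro X
        rw [Finset.sum_congr rfl (fun y _ => hωupd X y), ← Finset.sum_mul, hWsum]
      rw [Finset.sum_congr rfl (fun X _ => h2 X), ← Finset.mul_sum] at h1
      calc ∑ X : Fin m → Fin n → Bool, d * ((1 - η) * W) * ρ X
          = d * (1 - η) * (W * ∑ X : Fin m → Fin n → Bool, ρ X) := by rw [Finset.mul_sum, Finset.mul_sum]; refine Finset.sum_congr rfl fun X _ => ?_; ring
        _ = d * (1 - η) * (N * W ^ m) := by rw [h1]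
        _ = N * (d * ((1 - η) * W ^ m)) := by ring
    have hsumle : N * a (t + 1) ≤ (1 - d) * (N * a t) + N * (d * ((1 - η) * W ^ m)) := by
      rw [← hL, ← hR, ← hρW, Finset.mul_sum, ← Finset.sum_add_distrib]
      exact Finset.sum_le_sum fun X _ => hfib X
    have hkey : N * a (t + 1) ≤ N * ((1 - d) * a t + d * ((1 - η) * W ^ m)) := by
      calc N * a (t + 1) ≤ (1 - d) * (N * a t) + N * (d * ((1 - η) * W ^ m)) := hsumle
        _ = N * ((1 - d) * a t + d * ((1 - η) * W ^ m)) := by ring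
    exact le_of_mul_le_mul_left hkey hNpos
  -- iterate
  have hind : ∀ t : ℕ, t ≤ m → a t ≤ ((1 - η) + η * (1 - d) ^ t) * W ^ m := by
    intro t
    induction t with
    | zero =>
      intro _
      have hA0 : (univ.filter fun X : Fin m → Fin n → Bool => ∀ s : Fin m, (s : ℕ) < 0 → Win s X) = univ := by
        ext X
        simp
      show (∑ X ∈ univ.filter (fun X => ∀ s : Fin m, (s : ℕ) < 0 → Win s X), ω X) ≤ _
      rw [hA0, hSumω]
      ring_nf
      exact le_rfl
    | succ t ih =>
      intro ht
      have ht' : t < m := Nat.lt_of_succ_le ht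
      have h1d : 0 ≤ 1 - d := by linarith
      calc a (t + 1) ≤ (1 - d) * a t + d * ((1 - η) * W ^ m) := hstep t ht'
        _ ≤ (1 - d) * (((1 - η) + η * (1 - d) ^ t) * W ^ m) + d * ((1 - η) * W ^ m) :=
            add_le_add (mul_le_mul_of_nonneg_left (ih ht'.le) h1d) le_rfl
        _ = ((1 - η) + η * (1 - d) ^ (t + 1)) * W ^ m := by ring
  have hAm : (univ.filter fun X : Fin m → Fin n → Bool =>
      ∀ j, RingHLF.Rel (X j) (fun i => decide (P j i (flat X) = 1)))
      = univ.filter fun X => ∀ s : Fin m, (s : ℕ) < m → Win s X := by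
    ext X
    simp only [Win, mem_filter, mem_univ, true_and]
    exact ⟨fun h s _ => h s, fun h s => h s s.isLt⟩
  rw [hAm]
  exact hind m le_rfl

/-- **THE PROVED EDGE `SpreadDistOdd → MultiRingDistOdd`** (`K := k`, `θ := 1 - min η 1 / 2`; the measure is
carried along unchanged: T♭_μ holds for the SAME single-ring weight under which T**_μ holds). [kernel] -/
theorem multiRingDistOdd_of_spreadDistOdd (h : (∀ (p : ℕ) [Fact p.Prime], 5 ≤ p → ∃ η : ℝ, 0 < η ∧ ∀ c : ℕ, ∃ k t₀ : ℕ, ∀ t ≥ t₀, ∃ wt : (Fin (8 * t) → Bool) → ℕ, 0 < ∑ y, wt y ∧ ∀ P : Fin (8 * t) → Literature.Computability.MetaComplexity.Smolensky.CubeFn (ZMod p) (8 * t), (∀ i, P i ∈ Literature.Computability.MetaComplexity.Smolensky.lowDeg (ZMod p) (8 * t) ((Nat.log 2 (8 * t)) ^ c)) → ∀ m : ℕ, m ≤ (8 * t) ^ k → ∀ w : Fin m → Fin (8 * t) → Bool, ∀ Q : Fin m → Fin (8 * t) → Literature.Computability.MetaComplexity.Smolensky.CubeFn (ZMod p) (8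 * t), (∀ s i, Q s i ∈ Literature.Computability.MetaComplexity.Smolensky.lowDeg (ZMod p) (8 * t) ((Nat.log 2 (8 * t)) ^ c)) → (1 - η) * ((∑ y, wt y : ℕ) : ℝ) ≤ ((∑ y ∈ Finset.univ.filter (fun y : Fin (8 * t) → Bool => ∀ s, Literature.Computability.QuantumComplexity.RingHLF.Rel (w s) (fun i => decide (Q s i y = 1))), wt y : ℕ) : ℝ) → 1 / (((8 * t : ℕ) : ℝ)) ^ k * ((∑ y, wt y : ℕ) : ℝ) ≤ ((∑ y ∈ Finset.univ.filter (fun y : Fin (8 * t) → Bool => (∀ s, Literature.Computability.QuantumComplexity.RingHLF.Rel (w s) (fun i => decide (Q s i y = 1))) ∧ ¬ Literature.Computability.QuantumComplexity.RingHLF.Rel y (fun i => decide (P i y = 1))), wt y : ℕ) : ℝ))) : (∀ (p : ℕ) [Fact p.Prime], 5 ≤ p → ∃ θ : ℝ, θ < 1 ∧ ∀ c : ℕ, ∃ K t₀ : ℕ, ∀ t ≥ t₀, ∃ wt : (Fin (8 * t) → Bool) → ℕ, 0 < ∑ y, wt y ∧ ∀ P : Fin ((8 * t) ^ K) → Fin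 (8 * t) → Literature.Computability.MetaComplexity.Smolensky.CubeFn (ZMod p) ((8 * t) ^ K * (8 * t)), (∀ j i, P j i ∈ Literature.Computability.MetaComplexity.Smolensky.lowDeg (ZMod p) ((8 * t) ^ K * (8 * t)) ((Nat.log 2 (8 * t)) ^ c)) → (∑ X ∈ Finset.univ.filter (fun X : Fin ((8 * t) ^ K) → Fin (8 * t) → Bool => ∀ j, Literature.Computability.QuantumComplexity.RingHLF.Rel (X j) (fun i => decide (P j i (fun kk => X (finProdFinEquiv.symm kk).1 (finProdFinEquiv.symm kk).2) = 1))), ∏ j, ((wt (X j) : ℕ) : ℝ)) ≤ θ * ((∑ y, wt y : ℕ) : ℝ) ^ ((8 * t) ^ K)) := by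
  intro p _ hp
  obtain ⟨η, hη, hk⟩ := h p hp
  have hη' : 0 < min η 1 := lt_min hη one_pos
  have hη'1 : min η 1 ≤ 1 := min_le_right η 1
  have hη'η : min η 1 ≤ η := min_le_left η 1
  refine ⟨1 - min η 1 / 2, by linarith, fun c => ?_⟩
  obtain ⟨k, t₀, ht₀⟩ := hk c
  refine ⟨k, max t₀ 1, fun t ht => ?_⟩
  have htt₀ : t₀ ≤ t := le_of_max_le_left ht
  have ht1 : 1 ≤ t := le_of_max_le_right ht
  obtain ⟨wt, hwt, hS⟩ := ht₀ t htt₀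
  refine ⟨wt, hwt, fun P hP => ?_⟩
  have hn1 : 1 ≤ 8 * t := by omega
  have hn1r : (1 : ℝ) ≤ ((8 * t : ℕ) : ℝ) := by exact_mod_cast hn1
  have hd0 : (0 : ℝ) ≤ 1 / (((8 * t : ℕ) : ℝ)) ^ k := by positivity
  have hd1 : 1 / (((8 * t : ℕ) : ℝ)) ^ k ≤ 1 := by
    rw [div_le_one (by positivity)]; exact one_le_pow₀ hn1r
  have hW0 : (0 : ℝ) ≤ ((∑ y, wt y : ℕ) : ℝ) := by positivity
  have hyb := sum_winAll_le_hybrid_wt (p := p) (D := (Nat.log 2 (8 * t)) ^ c) hη'1 hd0 hd1 wt P hP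
    (fun Pv hPv t' ht' w Q hQ hE => hS Pv hPv t' ht'.le w Q hQ
      (le_trans (mul_le_mul_of_nonneg_right (by linarith) hW0) hE))
  refine le_trans hyb (mul_le_mul_of_nonneg_right ?_ (by positivity))
  have hq := Summit.QuantumAdvantage.QuantumAdvantage.Theorems.SpreadBridge.decay_le_half (k := k) hn1
  have hq' : (1 - 1 / (((8 * t : ℕ) : ℝ)) ^ k) ^ ((8 * t) ^ k) ≤ 1 / 2 := by exact_mod_cast hq
  nlinarith [mul_le_mul_of_nonneg_left hq' hη'.le]

/-- dominance over the flat many-ring grade is NOT claimed; the flat road is recorded in Part B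
(`multiRingDistOdd_of_multiRingHard8Odd`).  The composite PROVED edge to the closure: -/
theorem multiRingDistOdd_of_ringCore8Odd (h : RingCore8Odd) : (∀ (p : ℕ) [Fact p.Prime], 5 ≤ p → ∃ θ : ℝ, θ < 1 ∧ ∀ c : ℕ, ∃ K t₀ : ℕ, ∀ t ≥ t₀, ∃ wt : (Fin (8 * t) → Bool) → ℕ, 0 < ∑ y, wt y ∧ ∀ P : Fin ((8 * t) ^ K) → Fin (8 * t) → Literature.Computability.MetaComplexity.Smolensky.CubeFn (ZMod p) ((8 * t) ^ K * (8 * t)), (∀ j i, P j i ∈ Literature.Computability.MetaComplexity.Smolensky.lowDeg (ZMod p) ((8 * t) ^ K * (8 * t)) ((Nat.log 2 (8 * t)) ^ c)) → (∑ X ∈ Finset.univ.filter (fun X : Fin ((8 * t) ^ K) → Fin (8 * t) → Bool => ∀ j, Literature.Computability.QuantumComplexity.RingHLF.Rel (X j) (fun i => decide (P j i (fun kk => X (finProdFinEquiv.symm kk).1 (finProdFinEquiv.symm kk).2) = 1))), ∏ j, ((wt (X j) : ℕ) : ℝ)) ≤ θ * ((∑ y, wt y : ℕ) : ℝ) ^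 ((8 * t) ^ K)) :=
  multiRingDistOdd_of_spreadDistOdd (spreadDistOdd_of_ringCore8Odd h)


-- Part D (PackingMachinery: GridCycles / RowSquares) REMOVED for landing — it is the LANDED Theorems.MultiRingGridCycles / MultiRingRowSquares (census g5 p767120/p767159); imported instead (census g6).




end Summit.QuantumAdvantage.QuantumAdvantage.Theorems.SpreadCore
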